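import Mathlib.Data.Fintype.CardEmbedding
import Mathlib.Algebra.BigOperators.Group.Finset.Powerset
import Literature.MathematicalPhysics.QuantumFieldTheory.Dimock2011to13.QED3GaussianIntegralBound
import HarnessLib

/-!
# Dimock, *Quantum electrodynamics on the 3-torus I*, Appendix B (298)–(299): the antisymmetric-kernel representation
# `F(Ψ) = Σ_r (1/r!) Σ_{ξ₁…ξ_r} f_r(ξ₁,…,ξ_r) Ψ(ξ₁)⋯Ψ(ξ_r)` and `‖F‖_h = Σ_r (h^r/r!) ‖f_r‖₁` — PROVED equal to the
# monomial-basis forms of `QED3FermionNorm.lean`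

statement-level skeleton of published theorems with citation tags; proofs where landed; nothing here is a claim about the Yang–Mills mass gap

**Citation header (reproduction of PUBLISHED work).** J. Dimock, *Quantum electrodynamics on the 3-torus. I. First
step*, arXiv:math-ph/0210020 (2002) [Dimock2002QED3TorusI], **Appendix B** (298)–(299), p.62 L1–13 of the arXiv-v1 text
layer `paper:arxiv-math-ph_0210020`. Writer seat p11 (literature-prover-lit-balaban-p11-g15-0), YM LIT SWEEP item (c)
D12; fourth file of the App. B cluster (`QED3FermionNorm.lean`, `QED3GaussianIntegralBound.lean`,
`QED3FermionPartialIntegral.lean`).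

**The printed text (p.62 L1–13).** *"… the `Ψ(ξ)` generate the algebra and any element can be uniquely written
`F(Ψ) = Σ_r (1/r!) Σ_{ξ₁,…,ξ_r} f_r(ξ₁,…,ξ_r) Ψ(ξ₁)⋯Ψ(ξ_r)` (298) where the coefficients `f_r` are totally antisymmetric
functions. We define a norm `‖·‖_h` depending on a parameter `h > 0` by `‖F‖_h = Σ_r (h^r/r!) ‖f_r‖₁` (299) where `‖f_r‖₁`
is the `ℓ¹` norm."*

**What is here.** `QED3FermionNorm.lean` states (299) in the monomial basis, `hNorm h F = Σ_S h^{#S}|c_S(F)|`, with the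
reduction from the printed antisymmetric form explained in prose. This file makes that reduction a theorem:
* `monomialSign ξ` — the coefficient of `θ_{range ξ}` in the ordered product `Ψ(ξ₁)⋯Ψ(ξ_r)` (the tree's `genProd 𝕜 ξ`):
  `±1` for distinct letters (`monomialSign_mul_self`, with `genProd ξ = monomialSign ξ • θ_{range ξ}`,
  `genProd_eq_monomialSign_smul`), `0` otherwise (`genProd_eq_zero_of_not_injective` — a repeated generator kills the product);
* **`kernel F r`** — the totally antisymmetric coefficient functions `f_r` of (298): `f_r(ξ) = monomialSign ξ · c_{range ξ}(F)`;
  `kernel_comp_perm` (*"totally antisymmetric"*: `f_r(ξ∘σ) = sgn σ · f_r(ξ)`), `kernel_of_not_injective`;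
* **`expansion_298`** — `F = Σ_{r ≤ |ι|} (r!)⁻¹ Σ_ξ f_r(ξ) Ψ(ξ₁)⋯Ψ(ξ_r)`, through `sum_kernel_smul_genProd`
  (`Σ_ξ f_r(ξ)Ψ(ξ) = r!·Σ_{#S=r} c_Sθ_S`: each `r`-set is enumerated by exactly `r!` injective `ξ`,
  `card_injective_range_eq_factorial`);
* **`hNorm_eq_299`** — `‖F‖_h = Σ_{r ≤ |ι|} (h^r/r!) ‖f_r‖₁` with `‖f_r‖₁ = Σ_ξ |f_r(ξ)|` (`sum_norm_kernel`:
  `‖f_r‖₁ = r!·Σ_{#S=r}|c_S|`).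
Degrees `r > |ι|` carry no injective `ξ`, so the printed sums over all `r` reduce to `r ≤ |ι|` (`kernel_eq_zero_of_card_lt`).
(v1.1) **Uniqueness of (298)** (*"uniquely written"*): `kernel_unique` — any totally antisymmetric family `g_r` with
`F = Σ_{r≤|ι|} (1/r!) Σ_ξ g_r(ξ)Ψ(ξ₁)⋯Ψ(ξ_r)` coincides with `kernel F` in every degree `r ≤ |ι|` (antisymmetric functions
vanish on repeated letters; on the `r!` orderings of an `r`-set the product `g(ξ)Ψ(ξ)` is constant; basis coefficients are
unique). No named facts, no `sorry`.
-/

noncomputable section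

open Finset

namespace Literature.MathematicalPhysics.QuantumFieldTheory.Dimock2011to13

namespace QED3TorusI

open Literature.MathematicalPhysics.QuantumLattice
open Literature.MathematicalPhysics.QuantumLattice.GrassmannAlgebra

variable {𝕜 : Type*} [RCLike 𝕜] {ι : Type*} [LinearOrder ι] [Fintype ι]

/-! ## The ordered products `Ψ(ξ₁)⋯Ψ(ξ_r)` against the monomial basis -/

omit [Fintype ι] in
/-- A product `Ψ(ξ₁)⋯Ψ(ξ_r)` with a repeated letter vanishes. [cite: Dimock2002QED3TorusI, App. B (298) p.62 L4–8] -/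
theorem genProd_eq_zero_of_not_injective {r : ℕ} {ξ : Fin r → ι} (hξ : ¬Function.Injective ξ) :
    genProd 𝕜 ξ = 0 := by
  obtain ⟨i, j, hij, hne⟩ : ∃ i j, ξ i = ξ j ∧ i ≠ j := by
    by_contra h
    push Not at h
    exact hξ fun i j hij => (h i j hij)
  have hswap : ξ ∘ Equiv.swap i j = ξ := by
    funext k
    simp only [Function.comp_apply]
    by_cases hki : k = i
    · subst hki; rw [Equiv.swap_apply_left, hij]
    · by_cases hkj : k = j
      · subst hkj; rw [Equiv.swap_apply_right, hij]
      · rw [Equiv.swap_apply_of_ne_of_ne hki hkj]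
  have h := genProd_comp_perm 𝕜 ξ (Equiv.swap i j)
  rw [hswap, Equiv.Perm.sign_swap hne, Units.val_neg, Units.val_one, Int.cast_neg, Int.cast_one, neg_one_smul] at h
  -- `x = -x` forces `x = 0` in characteristic zero
  have h2 : (2 : 𝕜) • genProd 𝕜 ξ = 0 := by rw [two_smul]; nth_rewrite 1 [h]; exact neg_add_cancel _
  exact (smul_eq_zero.1 h2).resolve_left two_ne_zero

/-- The letters of `ξ`. [cite: Dimock2002QED3TorusI, App. B (298) p.62 L4–8] -/
abbrev letters {r : ℕ} (ξ : Fin r → ι) : Finset ι := univ.image ξ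

omit [LinearOrder ι] [Fintype ι] in
/-- Distinct letters: `#(letters ξ) = r`. [cite: Dimock2002QED3TorusI, App. B (298) p.62 L4–8] -/
theorem card_letters_of_injective [DecidableEq ι] {r : ℕ} {ξ : Fin r → ι} (hξ : Function.Injective ξ) :
    (univ.image ξ).card = r := by
  rw [card_image_of_injective _ hξ, card_univ, Fintype.card_fin]

/-- The basis monomial with a prescribed number of letters, enumerated increasingly, as a `genProd`.
[cite: Dimock2002QED3TorusI, App. B (298) p.62 L4–8] -/
theorem grassmannBasis_eq_genProd_of_card (S : Finset ι) {r : ℕ} (h : S.card = r) :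
    grassmannBasis 𝕜 ι S = genProd 𝕜 (fun i : Fin r => S.orderEmbOfFin h i) := by
  subst h
  exact grassmannBasis_eq_genProd_orderEmb S

/-- For distinct letters, sorting `ξ` gives the increasing enumeration of its letters, so
`Ψ(ξ₁)⋯Ψ(ξ_r) = sgn(sort ξ) · θ_{letters ξ}`. [cite: Dimock2002QED3TorusI, App. B (298) p.62 L4–8] -/
theorem genProd_eq_sign_sort_smul {r : ℕ} {ξ : Fin r → ι} (hξ : Function.Injective ξ) :
    genProd 𝕜 ξ = ((Equiv.Perm.sign (Tuple.sort ξ) : ℤ) : 𝕜) • grassmannBasis 𝕜 ι (letters ξ) := by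
  have hcard : (letters ξ).card = r := card_letters_of_injective hξ
  have hmono : StrictMono (ξ ∘ Tuple.sort ξ) :=
    (Tuple.monotone_sort ξ).strictMono_of_injective (hξ.comp (Tuple.sort ξ).injective)
  have hsorted : ξ ∘ Tuple.sort ξ = fun i => (letters ξ).orderEmbOfFin hcard i :=
    Finset.orderEmbOfFin_unique hcard (fun i => mem_image_of_mem _ (mem_univ _)) hmono
  have h := genProd_comp_perm 𝕜 ξ (Tuple.sort ξ)
  rw [hsorted, ← grassmannBasis_eq_genProd_of_card] at h
  -- `θ = sgn • genProd ξ` ⇒ `genProd ξ = sgn • θ` (`sgn² = 1`)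
  rw [h, smul_smul, ← Int.cast_mul, ← Units.val_mul, Int.units_mul_self, Units.val_one, Int.cast_one, one_smul]

/-- **The sign of an ordered product**: the coefficient of `θ_{letters ξ}` in `Ψ(ξ₁)⋯Ψ(ξ_r)` (`±1` for distinct letters,
`0` otherwise). [cite: Dimock2002QED3TorusI, App. B (298) p.62 L4–8] -/
def monomialSign {r : ℕ} (ξ : Fin r → ι) : 𝕜 := coeff (genProd 𝕜 ξ) (letters ξ)

/-- For distinct letters the sign is `sgn(sort ξ)`. [cite: Dimock2002QED3TorusI, App. B (298) p.62 L4–8] -/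
theorem monomialSign_of_injective {r : ℕ} {ξ : Fin r → ι} (hξ : Function.Injective ξ) :
    (monomialSign ξ : 𝕜) = ((Equiv.Perm.sign (Tuple.sort ξ) : ℤ) : 𝕜) := by
  rw [monomialSign, genProd_eq_sign_sort_smul hξ, coeff, map_smul, Module.Basis.repr_self, Finsupp.smul_apply,
    Finsupp.single_eq_same, smul_eq_mul, mul_one]

/-- With a repeated letter the sign is `0`. [cite: Dimock2002QED3TorusI, App. B (298) p.62 L4–8] -/
theorem monomialSign_of_not_injective {r : ℕ} {ξ : Fin r → ι} (hξ : ¬Function.Injective ξ) :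
    (monomialSign ξ : 𝕜) = 0 := by
  rw [monomialSign, genProd_eq_zero_of_not_injective hξ, coeff, map_zero, Finsupp.zero_apply]

/-- `Ψ(ξ₁)⋯Ψ(ξ_r) = monomialSign ξ • θ_{letters ξ}`. [cite: Dimock2002QED3TorusI, App. B (298) p.62 L4–8] -/
theorem genProd_eq_monomialSign_smul {r : ℕ} (ξ : Fin r → ι) :
    genProd 𝕜 ξ = (monomialSign ξ : 𝕜) • grassmannBasis 𝕜 ι (letters ξ) := by
  by_cases hξ : Function.Injective ξ
  · rw [monomialSign_of_injective hξ, genProd_eq_sign_sort_smul hξ]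
  · rw [monomialSign_of_not_injective hξ, genProd_eq_zero_of_not_injective hξ, zero_smul]

/-- `monomialSign ξ ∈ {±1}` for distinct letters: its square is `1`. [cite: Dimock2002QED3TorusI, App. B (298) p.62 L4–8] -/
theorem monomialSign_mul_self {r : ℕ} {ξ : Fin r → ι} (hξ : Function.Injective ξ) :
    (monomialSign ξ : 𝕜) * monomialSign ξ = 1 := by
  rw [monomialSign_of_injective hξ, ← Int.cast_mul, ← Units.val_mul, Int.units_mul_self, Units.val_one, Int.cast_one]

/-- `|monomialSign ξ| = 1` for distinct letters. [cite: Dimock2002QED3TorusI, App. B (298) p.62 L4–8] -/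
theorem norm_monomialSign_of_injective {r : ℕ} {ξ : Fin r → ι} (hξ : Function.Injective ξ) :
    ‖(monomialSign ξ : 𝕜)‖ = 1 := by
  rw [monomialSign_of_injective hξ]
  rcases Int.units_eq_one_or (Equiv.Perm.sign (Tuple.sort ξ)) with h | h <;> simp [h]

/-! ## (298): the totally antisymmetric kernels `f_r` -/

/-- **The kernels `f_r` of (298)**: `f_r(ξ₁,…,ξ_r) = monomialSign ξ · c_{letters ξ}(F)` — the unique totally antisymmetric
functions with `F = Σ_r (1/r!) Σ_ξ f_r(ξ) Ψ(ξ₁)⋯Ψ(ξ_r)`. [cite: Dimock2002QED3TorusI, App. B (298) p.62 L4–8] -/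
def kernel (F : GrassmannAlgebra 𝕜 ι) (r : ℕ) (ξ : Fin r → ι) : 𝕜 := monomialSign ξ * coeff F (letters ξ)

/-- `f_r` vanishes on tuples with a repeated letter. [cite: Dimock2002QED3TorusI, App. B (298) p.62 L7–8 («totally antisymmetric»)] -/
theorem kernel_of_not_injective (F : GrassmannAlgebra 𝕜 ι) {r : ℕ} {ξ : Fin r → ι} (hξ : ¬Function.Injective ξ) :
    kernel F r ξ = 0 := by
  rw [kernel, monomialSign_of_not_injective hξ, zero_mul]

omit [LinearOrder ι] [Fintype ι] in
/-- Permuting a tuple does not change its letters. [cite: Dimock2002QED3TorusI, App. B (298) p.62 L7–8] -/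
theorem letters_comp_perm [DecidableEq ι] {r : ℕ} (ξ : Fin r → ι) (σ : Equiv.Perm (Fin r)) :
    univ.image (ξ ∘ σ) = univ.image ξ := by
  rw [← Finset.image_image, Finset.image_univ_equiv]

/-- **`f_r` is totally antisymmetric**: `f_r(ξ_{σ(1)},…,ξ_{σ(r)}) = sgn σ · f_r(ξ₁,…,ξ_r)`.
[cite: Dimock2002QED3TorusI, App. B (298) p.62 L7–8 («the coefficients f_r are totally antisymmetric functions»)] -/
theorem kernel_comp_perm (F : GrassmannAlgebra 𝕜 ι) {r : ℕ} (ξ : Fin r → ι) (σ : Equiv.Perm (Fin r)) :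
    kernel F r (ξ ∘ σ) = ((Equiv.Perm.sign σ : ℤ) : 𝕜) * kernel F r ξ := by
  unfold kernel monomialSign letters
  rw [letters_comp_perm, genProd_comp_perm, coeff, map_smul, Finsupp.smul_apply, smul_eq_mul, mul_assoc]

/-- One term of (298): `f_r(ξ) Ψ(ξ₁)⋯Ψ(ξ_r) = c_{letters ξ} θ_{letters ξ}` for distinct letters, `0` otherwise.
[cite: Dimock2002QED3TorusI, App. B (298) p.62 L4–8] -/
theorem kernel_smul_genProd (F : GrassmannAlgebra 𝕜 ι) {r : ℕ} (ξ : Fin r → ι) :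
    kernel F r ξ • genProd 𝕜 ξ =
      if Function.Injective ξ then coeff F (letters ξ) • grassmannBasis 𝕜 ι (letters ξ) else 0 := by
  split_ifs with hξ
  · rw [genProd_eq_monomialSign_smul, smul_smul, kernel, mul_comm (monomialSign ξ), mul_assoc,
      monomialSign_mul_self hξ, mul_one]
  · rw [genProd_eq_zero_of_not_injective hξ, smul_zero]

/-! ## Counting: each `r`-set of letters is enumerated by `r!` tuples -/

omit [LinearOrder ι] in
/-- Injective `ξ : Fin r → ι` with letters in `S`, as embeddings `Fin r ↪ S`. [folklore] -/
private def embOfInj [DecidableEq ι] (S : Finset ι) {r : ℕ} :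
    {ξ : Fin r → ι // Function.Injective ξ ∧ univ.image ξ ⊆ S} ≃ (Fin r ↪ S) where
  toFun ξ := ⟨fun i => ⟨ξ.1 i, ξ.2.2 (mem_image_of_mem _ (mem_univ i))⟩,
    fun i j h => ξ.2.1 (congrArg Subtype.val h)⟩
  invFun e := ⟨fun i => (e i : ι), ⟨fun i j h => e.injective (Subtype.ext h),
    fun x hx => by obtain ⟨i, _, rfl⟩ := mem_image.1 hx; exact (e i).2⟩⟩
  left_inv ξ := by rfl
  right_inv e := by rfl

omit [LinearOrder ι] [Fintype ι] in
/-- For injective `ξ` and `#S = r`: letters `⊆ S` iff letters `= S`. [folklore] -/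
private theorem image_eq_iff_subset [DecidableEq ι] {S : Finset ι} {r : ℕ} (hS : S.card = r) {ξ : Fin r → ι}
    (hξ : Function.Injective ξ) : univ.image ξ = S ↔ univ.image ξ ⊆ S := by
  refine ⟨fun h => h.le, fun h => Finset.eq_of_subset_of_card_le h ?_⟩
  rw [hS, card_letters_of_injective hξ]

omit [LinearOrder ι] in
/-- **Exactly `r!` tuples of distinct letters enumerate a given `r`-set** — the `r!` ∕ `1/r!` of (298)–(299).
[cite: Dimock2002QED3TorusI, App. B (298)–(299) p.62 L4–13] -/
theorem card_injective_range_eq_factorial [DecidableEq ι] (S : Finset ι) {r : ℕ} (hS : S.card = r) :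
    (univ.filter fun ξ : Fin r → ι => Function.Injective ξ ∧ univ.image ξ = S).card = r.factorial := by
  have h1 : (univ.filter fun ξ : Fin r → ι => Function.Injective ξ ∧ univ.image ξ = S).card =
      Fintype.card {ξ : Fin r → ι // Function.Injective ξ ∧ univ.image ξ ⊆ S} := by
    rw [Fintype.card_subtype]
    congr 1
    ext ξ
    simp only [mem_filter, mem_univ, true_and]
    exact ⟨fun h => ⟨h.1, (image_eq_iff_subset hS h.1).1 h.2⟩, fun h => ⟨h.1, (image_eq_iff_subset hS h.1).2 h.2⟩⟩
  rw [h1, Fintype.card_congr (embOfInj S), Fintype.card_embedding_eq, Fintype.card_coe, hS, Fintype.card_fin,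
    Nat.descFactorial_self]

/-! ## (298) and (299) as theorems -/

/-- **`Σ_ξ f_r(ξ) Ψ(ξ₁)⋯Ψ(ξ_r) = r! · Σ_{#S = r} c_S θ_S`** — the `r!` of (298) counts the orderings of each `r`-set.
[cite: Dimock2002QED3TorusI, App. B (298) p.62 L4–8] -/
theorem sum_kernel_smul_genProd (F : GrassmannAlgebra 𝕜 ι) (r : ℕ) :
    ∑ ξ : Fin r → ι, kernel F r ξ • genProd 𝕜 ξ =
      (r.factorial : 𝕜) • ∑ S ∈ powersetCard r univ, coeff F S • grassmannBasis 𝕜 ι S := by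
  classical
  simp only [kernel_smul_genProd]
  -- group the tuples by their set of letters
  rw [← Finset.sum_fiberwise univ (fun ξ : Fin r → ι => univ.image ξ)
    (fun ξ => if Function.Injective ξ then coeff F (letters ξ) • grassmannBasis 𝕜 ι (letters ξ) else 0)]
  rw [Finset.smul_sum, ← Finset.sum_subset (subset_univ (powersetCard r univ))]
  · refine Finset.sum_congr rfl fun S hS => ?_
    have hSr : S.card = r := (mem_powersetCard.1 hS).2
    -- on the fibre of `S` the summand is the constant `c_S θ_S` on injective `ξ`, `0` on the others
    rw [← Finset.sum_filter_add_sum_filter_not _ (fun ξ : Fin r → ι => Function.Injective ξ)]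
    have hz : ∑ ξ ∈ (univ.filter fun ξ : Fin r → ι => univ.image ξ = S).filter
        (fun ξ => ¬Function.Injective ξ),
        (if Function.Injective ξ then coeff F (letters ξ) • grassmannBasis 𝕜 ι (letters ξ) else 0) = 0 :=
      Finset.sum_eq_zero fun ξ hξ => by rw [if_neg (mem_filter.1 hξ).2]
    rw [hz, add_zero, Finset.filter_filter]
    have hconst : ∀ ξ ∈ univ.filter (fun ξ : Fin r → ι => univ.image ξ = S ∧ Function.Injective ξ),
        (if Function.Injective ξ then coeff F (letters ξ) • grassmannBasis 𝕜 ι (letters ξ) else 0) =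
          coeff F S • grassmannBasis 𝕜 ι S := by
      intro ξ hξ
      obtain ⟨h1, h2⟩ := (mem_filter.1 hξ).2
      rw [if_pos h2, letters, h1]
    rw [Finset.sum_congr rfl hconst, Finset.sum_const, ← Nat.cast_smul_eq_nsmul 𝕜]
    congr 1
    rw [show (univ.filter fun ξ : Fin r → ι => univ.image ξ = S ∧ Function.Injective ξ) =
        univ.filter (fun ξ : Fin r → ι => Function.Injective ξ ∧ univ.image ξ = S) from
      Finset.filter_congr fun ξ _ => and_comm, card_injective_range_eq_factorial S hSr]
  · -- sets of the wrong cardinality have empty fibre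
    intro S _ hS
    refine Finset.sum_eq_zero fun ξ hξ => ?_
    split_ifs with hinj
    · exfalso
      refine hS (mem_powersetCard.2 ⟨subset_univ _, ?_⟩)
      rw [← (mem_filter.1 hξ).2, card_letters_of_injective hinj]
    · rfl

/-- In degrees above the number of generators every kernel vanishes (no injective `ξ`).
[cite: Dimock2002QED3TorusI, App. B (298) p.62 L4–8] -/
theorem kernel_eq_zero_of_card_lt (F : GrassmannAlgebra 𝕜 ι) {r : ℕ} (hr : Fintype.card ι < r) (ξ : Fin r → ι) :
    kernel F r ξ = 0 :=
  kernel_of_not_injective F fun hξ => by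
    have := Fintype.card_le_of_injective ξ hξ
    rw [Fintype.card_fin] at this
    omega

/-- **(298)**: `F = Σ_{r=0}^{|ι|} (1/r!) Σ_{ξ₁,…,ξ_r} f_r(ξ₁,…,ξ_r) Ψ(ξ₁)⋯Ψ(ξ_r)`.
[cite: Dimock2002QED3TorusI, App. B (298) p.62 L4–8] -/
theorem expansion_298 (F : GrassmannAlgebra 𝕜 ι) :
    F = ∑ r ∈ range (Fintype.card ι + 1), ((r.factorial : 𝕜)⁻¹) • ∑ ξ : Fin r → ι, kernel F r ξ • genProd 𝕜 ξ := by
  classical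
  simp only [sum_kernel_smul_genProd, smul_smul]
  have hfac : ∀ r : ℕ, ((r.factorial : 𝕜)⁻¹) * (r.factorial : 𝕜) = 1 := fun r =>
    inv_mul_cancel₀ (Nat.cast_ne_zero.2 (Nat.factorial_ne_zero r))
  simp only [hfac, one_smul]
  rw [← card_univ, ← Finset.sum_powerset, powerset_univ]
  exact ((grassmannBasis 𝕜 ι).sum_repr F).symm

/-- **`‖f_r‖₁ = r! · Σ_{#S=r} |c_S|`.** [cite: Dimock2002QED3TorusI, App. B (299) p.62 L9–13] -/
theorem sum_norm_kernel (F : GrassmannAlgebra 𝕜 ι) (r : ℕ) :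
    ∑ ξ : Fin r → ι, ‖kernel F r ξ‖ = (r.factorial : ℝ) * ∑ S ∈ powersetCard r univ, ‖coeff F S‖ := by
  classical
  have hk : ∀ ξ : Fin r → ι, ‖kernel F r ξ‖ = if Function.Injective ξ then ‖coeff F (letters ξ)‖ else 0 := by
    intro ξ
    split_ifs with hξ
    · rw [kernel, norm_mul, norm_monomialSign_of_injective hξ, one_mul]
    · rw [kernel_of_not_injective F hξ, norm_zero]
  simp only [hk]
  rw [← Finset.sum_fiberwise univ (fun ξ : Fin r → ι => univ.image ξ)
    (fun ξ => if Function.Injective ξ then ‖coeff F (letters ξ)‖ else 0)]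
  rw [Finset.mul_sum, ← Finset.sum_subset (subset_univ (powersetCard r univ))]
  · refine Finset.sum_congr rfl fun S hS => ?_
    have hSr : S.card = r := (mem_powersetCard.1 hS).2
    rw [← Finset.sum_filter_add_sum_filter_not _ (fun ξ : Fin r → ι => Function.Injective ξ)]
    have hz : ∑ ξ ∈ (univ.filter fun ξ : Fin r → ι => univ.image ξ = S).filter
        (fun ξ => ¬Function.Injective ξ), (if Function.Injective ξ then ‖coeff F (letters ξ)‖ else 0) = 0 :=
      Finset.sum_eq_zero fun ξ hξ => by rw [if_neg (mem_filter.1 hξ).2]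
    rw [hz, add_zero, Finset.filter_filter]
    have hconst : ∀ ξ ∈ univ.filter (fun ξ : Fin r → ι => univ.image ξ = S ∧ Function.Injective ξ),
        (if Function.Injective ξ then ‖coeff F (letters ξ)‖ else 0) = ‖coeff F S‖ := by
      intro ξ hξ
      obtain ⟨h1, h2⟩ := (mem_filter.1 hξ).2
      rw [if_pos h2, letters, h1]
    rw [Finset.sum_congr rfl hconst, Finset.sum_const, nsmul_eq_mul]
    congr 1
    rw [show (univ.filter fun ξ : Fin r → ι => univ.image ξ = S ∧ Function.Injective ξ) =
        univ.filter (fun ξ : Fin r → ι => Function.Injective ξ ∧ univ.image ξ = S) from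
      Finset.filter_congr fun ξ _ => and_comm, card_injective_range_eq_factorial S hSr]
  · intro S _ hS
    refine Finset.sum_eq_zero fun ξ hξ => ?_
    split_ifs with hinj
    · exfalso
      refine hS (mem_powersetCard.2 ⟨subset_univ _, ?_⟩)
      rw [← (mem_filter.1 hξ).2, card_letters_of_injective hinj]
    · rfl

/-- **(299)**: `‖F‖_h = Σ_{r=0}^{|ι|} (h^r/r!) ‖f_r‖₁` — the printed norm IS the monomial-basis norm `hNorm h F`.
[cite: Dimock2002QED3TorusI, App. B (299) p.62 L9–13] -/
theorem hNorm_eq_299 (h : ℝ) (F : GrassmannAlgebra 𝕜 ι) :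
    hNorm h F = ∑ r ∈ range (Fintype.card ι + 1), h ^ r / (r.factorial : ℝ) * ∑ ξ : Fin r → ι, ‖kernel F r ξ‖ := by
  classical
  simp only [sum_norm_kernel]
  have hfac : ∀ r : ℕ, h ^ r / (r.factorial : ℝ) * ((r.factorial : ℝ) * ∑ S ∈ powersetCard r univ, ‖coeff F S‖) =
      ∑ S ∈ powersetCard r univ, h ^ S.card * ‖coeff F S‖ := by
    intro r
    rw [← mul_assoc, div_mul_cancel₀ _ (Nat.cast_ne_zero.2 (Nat.factorial_ne_zero r)), Finset.mul_sum]
    exact Finset.sum_congr rfl fun S hS => by rw [(mem_powersetCard.1 hS).2]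
  simp only [hfac]
  rw [← card_univ, ← Finset.sum_powerset, powerset_univ]
  rfl

/-! ## (298), uniqueness: a totally antisymmetric family reproducing `F` is `kernel F` (v1.1) -/

omit [Fintype ι] in
/-- A totally antisymmetric function vanishes on tuples with a repeated letter (characteristic `0`).
[cite: Dimock2002QED3TorusI, App. B (298) p.62 L7–8] -/
theorem eq_zero_of_antisymm_of_not_injective {r : ℕ} {g : (Fin r → ι) → 𝕜}
    (hg : ∀ (ξ : Fin r → ι) (σ : Equiv.Perm (Fin r)), g (ξ ∘ σ) = ((Equiv.Perm.sign σ : ℤ) : 𝕜) * g ξ)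
    {ξ : Fin r → ι} (hξ : ¬Function.Injective ξ) : g ξ = 0 := by
  obtain ⟨i, j, hij, hne⟩ : ∃ i j, ξ i = ξ j ∧ i ≠ j := by
    by_contra h
    push Not at h
    exact hξ fun i j hij => (h i j hij)
  have hswap : ξ ∘ Equiv.swap i j = ξ := by
    funext k
    simp only [Function.comp_apply]
    by_cases hki : k = i
    · subst hki; rw [Equiv.swap_apply_left, hij]
    · by_cases hkj : k = j
      · subst hkj; rw [Equiv.swap_apply_right, hij]
      · rw [Equiv.swap_apply_of_ne_of_ne hki hkj]
  have h := hg ξ (Equiv.swap i j)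
  rw [hswap, Equiv.Perm.sign_swap hne, Units.val_neg, Units.val_one, Int.cast_neg, Int.cast_one, neg_one_mul] at h
  have h2 : (2 : 𝕜) * g ξ = 0 := by rw [two_mul]; nth_rewrite 1 [h]; exact neg_add_cancel _
  exact (mul_eq_zero.1 h2).resolve_left two_ne_zero

/-- On the fibre of an `r`-set `S`, an antisymmetric `g` times the ordered product is CONSTANT:
`g(ξ) Ψ(ξ₁)⋯Ψ(ξ_r) = g(ξ_S) θ_S` with `ξ_S` the increasing enumeration of `S`. [cite: Dimock2002QED3TorusI, App. B (298) p.62 L4–8] -/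
theorem antisymm_smul_genProd_eq {r : ℕ} {g : (Fin r → ι) → 𝕜}
    (hg : ∀ (ξ : Fin r → ι) (σ : Equiv.Perm (Fin r)), g (ξ ∘ σ) = ((Equiv.Perm.sign σ : ℤ) : 𝕜) * g ξ)
    {ξ : Fin r → ι} (hξ : Function.Injective ξ) :
    g ξ • genProd 𝕜 ξ =
      g (fun i => (letters ξ).orderEmbOfFin (card_letters_of_injective hξ) i) • grassmannBasis 𝕜 ι (letters ξ) := by
  set σ := Tuple.sort ξ with hσ
  have hcard : (letters ξ).card = r := card_letters_of_injective hξ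
  have hmono : StrictMono (ξ ∘ σ) := (Tuple.monotone_sort ξ).strictMono_of_injective (hξ.comp σ.injective)
  have hsorted : ξ ∘ σ = fun i => (letters ξ).orderEmbOfFin hcard i :=
    Finset.orderEmbOfFin_unique hcard (fun i => mem_image_of_mem _ (mem_univ _)) hmono
  rw [← hsorted, hg ξ σ, genProd_eq_sign_sort_smul hξ, smul_smul, ← hσ]
  congr 1
  ring

/-- **(298), uniqueness.** If totally antisymmetric `g_r` reproduce `F = Σ_{r ≤ |ι|} (1/r!) Σ_ξ g_r(ξ) Ψ(ξ₁)⋯Ψ(ξ_r)`, then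
`g_r = f_r` (`= kernel F r`) in every degree `r ≤ |ι|` — *"any element can be uniquely written"* (298).
[cite: Dimock2002QED3TorusI, App. B (298) p.62 L4–8 («uniquely written»)] -/
theorem kernel_unique (F : GrassmannAlgebra 𝕜 ι) (g : (r : ℕ) → (Fin r → ι) → 𝕜)
    (hg : ∀ r (ξ : Fin r → ι) (σ : Equiv.Perm (Fin r)), g r (ξ ∘ σ) = ((Equiv.Perm.sign σ : ℤ) : 𝕜) * g r ξ)
    (hF : F = ∑ r ∈ range (Fintype.card ι + 1), ((r.factorial : 𝕜)⁻¹) • ∑ ξ : Fin r → ι, g r ξ • genProd 𝕜 ξ)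
    {r : ℕ} (hr : r ≤ Fintype.card ι) (ξ : Fin r → ι) : g r ξ = kernel F r ξ := by
  classical
  -- Step 1: the fibre sums. For every degree `r` and `r`-set `S`, with `ξ_S` its increasing enumeration,
  -- `Σ_ξ g_r(ξ)Ψ(ξ) = r! Σ_{#S=r} g_r(ξ_S) θ_S`.
  have hfibre : ∀ r : ℕ, ∑ ξ : Fin r → ι, g r ξ • genProd 𝕜 ξ =
      (r.factorial : 𝕜) • ∑ S ∈ powersetCard r univ,
        (if h : S.card = r then g r (fun i => S.orderEmbOfFin h i) else 0) • grassmannBasis 𝕜 ι S := by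
    intro r
    have hterm : ∀ ξ : Fin r → ι, g r ξ • genProd 𝕜 ξ =
        if hξ : Function.Injective ξ then
          g r (fun i => (letters ξ).orderEmbOfFin (card_letters_of_injective hξ) i) • grassmannBasis 𝕜 ι (letters ξ)
        else 0 := by
      intro ξ
      split_ifs with hξ
      · exact antisymm_smul_genProd_eq (hg r) hξ
      · rw [eq_zero_of_antisymm_of_not_injective (hg r) hξ, zero_smul]
    simp only [hterm]
    rw [← Finset.sum_fiberwise univ (fun ξ : Fin r → ι => univ.image ξ)
      (fun ξ => if hξ : Function.Injective ξ then
          g r (fun i => (letters ξ).orderEmbOfFin (card_letters_of_injective hξ) i) • grassmannBasis 𝕜 ι (letters ξ)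
        else 0)]
    rw [Finset.smul_sum, ← Finset.sum_subset (subset_univ (powersetCard r univ))]
    · refine Finset.sum_congr rfl fun S hS => ?_
      have hSr : S.card = r := (mem_powersetCard.1 hS).2
      rw [dif_pos hSr, ← Finset.sum_filter_add_sum_filter_not _ (fun ξ : Fin r → ι => Function.Injective ξ)]
      have hz : ∑ ξ ∈ (univ.filter fun ξ : Fin r → ι => univ.image ξ = S).filter (fun ξ => ¬Function.Injective ξ),
          (if hξ : Function.Injective ξ then
            g r (fun i => (letters ξ).orderEmbOfFin (card_letters_of_injective hξ) i) • grassmannBasis 𝕜 ι (letters ξ)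
          else 0) = 0 :=
        Finset.sum_eq_zero fun ξ hξ => by rw [dif_neg (mem_filter.1 hξ).2]
      rw [hz, add_zero, Finset.filter_filter]
      have hconst : ∀ ξ ∈ univ.filter (fun ξ : Fin r → ι => univ.image ξ = S ∧ Function.Injective ξ),
          (if hξ : Function.Injective ξ then
            g r (fun i => (letters ξ).orderEmbOfFin (card_letters_of_injective hξ) i) • grassmannBasis 𝕜 ι (letters ξ)
          else 0) = g r (fun i => S.orderEmbOfFin hSr i) • grassmannBasis 𝕜 ι S := by
        intro ξ hξ
        obtain ⟨h1, h2⟩ := (mem_filter.1 hξ).2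
        rw [dif_pos h2]
        have h1' : letters ξ = S := h1
        subst h1'
        rfl
      rw [Finset.sum_congr rfl hconst, Finset.sum_const, ← Nat.cast_smul_eq_nsmul 𝕜]
      congr 1
      rw [show (univ.filter fun ξ : Fin r → ι => univ.image ξ = S ∧ Function.Injective ξ) =
          univ.filter (fun ξ : Fin r → ι => Function.Injective ξ ∧ univ.image ξ = S) from
        Finset.filter_congr fun ξ _ => and_comm, card_injective_range_eq_factorial S hSr]
    · intro S _ hS
      refine Finset.sum_eq_zero fun ξ hξ => ?_
      split_ifs with hinj
      · exfalso
        refine hS (mem_powersetCard.2 ⟨subset_univ _, ?_⟩)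
        rw [← (mem_filter.1 hξ).2, card_letters_of_injective hinj]
      · rfl
  -- Step 2: hence `F = Σ_S g(ξ_S) θ_S`, and basis coefficients are unique: `c_S(F) = g_{#S}(ξ_S)`.
  have hcoeff : ∀ S : Finset ι, coeff F S = g S.card (fun i => S.orderEmbOfFin rfl i) := by
    have hF' : F = ∑ S : Finset ι, (g S.card fun i => S.orderEmbOfFin rfl i) • grassmannBasis 𝕜 ι S := by
      conv_lhs => rw [hF]
      simp only [hfibre, smul_smul]
      have hfac : ∀ r : ℕ, ((r.factorial : 𝕜)⁻¹) * (r.factorial : 𝕜) = 1 := fun r =>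
        inv_mul_cancel₀ (Nat.cast_ne_zero.2 (Nat.factorial_ne_zero r))
      simp only [hfac, one_smul]
      have hinner : ∀ x : ℕ, ∑ S ∈ powersetCard x (univ : Finset ι),
          (if h : S.card = x then g x (fun i => S.orderEmbOfFin h i) else 0) • grassmannBasis 𝕜 ι S =
          ∑ S ∈ powersetCard x (univ : Finset ι), (g S.card fun i => S.orderEmbOfFin rfl i) • grassmannBasis 𝕜 ι S := by
        intro x
        refine Finset.sum_congr rfl fun S hS => ?_
        have hSx : S.card = x := (mem_powersetCard.1 hS).2
        subst hSx
        rw [dif_pos rfl]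
      simp only [hinner]
      rw [← card_univ, ← Finset.sum_powerset, powerset_univ]
    intro S
    have h := congrArg (fun x => (grassmannBasis 𝕜 ι).repr x S) hF'
    simp only [map_sum, map_smul, Module.Basis.repr_self, Finsupp.coe_finsetSum, Finset.sum_apply,
      Finsupp.smul_apply, smul_eq_mul] at h
    rw [coeff, h, Finset.sum_eq_single S]
    · rw [Finsupp.single_eq_same, mul_one]
    · intro T _ hTS
      rw [Finsupp.single_eq_of_ne (Ne.symm hTS), mul_zero]
    · intro hS
      exact absurd (mem_univ S) hS
  -- Step 3: read off `g_r(ξ) = monomialSign ξ · c_{letters ξ} = kernel F r ξ`.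
  by_cases hξ : Function.Injective ξ
  · have hcard : (letters ξ).card = r := card_letters_of_injective hξ
    have key := antisymm_smul_genProd_eq (hg r) hξ
    rw [genProd_eq_monomialSign_smul, smul_smul] at key
    -- compare coefficients of `θ_{letters ξ}` on both sides
    have key' := congrArg (fun x => (grassmannBasis 𝕜 ι).repr x (letters ξ)) key
    simp only [map_smul, Module.Basis.repr_self, Finsupp.smul_apply, Finsupp.single_eq_same, smul_eq_mul,
      mul_one] at key'
    -- `key' : g r ξ * monomialSign ξ = g r ξ_S`
    rw [kernel, hcoeff]
    have hS : g r (fun i => (letters ξ).orderEmbOfFin hcard i) =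
        g (letters ξ).card (fun i => (letters ξ).orderEmbOfFin rfl i) := by
      clear key key'
      revert hcard
      generalize letters ξ = S
      intro hcard
      subst hcard
      rfl
    rw [← hS, ← key', mul_comm (g r ξ), ← mul_assoc, monomialSign_mul_self hξ, one_mul]
  · rw [kernel_of_not_injective F hξ, eq_zero_of_antisymm_of_not_injective (hg r) hξ]

end QED3TorusI

end Literature.MathematicalPhysics.QuantumFieldTheory.Dimock2011to13
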